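/- Width seat `ym-line-cbag-p1-w2` (prover-ym-line-cbag-p1-w2-g15-0; own items stmt-QuantumFields-22254 / 22893 CLOSED) on the
planner-of-record's LINE 4, route `U1DipoleHelicity`, crux `WilsonU1DipoleLawD4` (stmt-QuantumFields-25880): dipole decay of the
route-posited free photon kernel `freeK` (`|K(z)| ≤ C ‖z‖_∞⁻⁴`), from `freeK = curvatureTwoPoint` and the tree's decay bounds for second
differences of the `d = 4` lattice Green function.  Helper `--supports stmt-QuantumFields-25880`; no stub is closed here.  Nothing in
this file bears on the Yang–Mills mass gap. -/
import Summits.QuantumFields.YangMills.Theorems.U1DipoleHelicityFreeKCurvatureTwoPoint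
import Summits.QuantumFields.YangMills.Theorems.LogWindowMixedDominanceGreenDecay
import Literature.Probability.LatticeModels.LatticeGreenPoisson
import HarnessLib

/-!
# Crux `WilsonU1DipoleLawD4` (stmt-QuantumFields-25880): dipole decay of the free photon kernel `freeK`

Both registered stubs of the crux compare two-plaquette functions with `freeK z / β'` up to errors weighted by `(1+|z|₁)⁻⁵`; every such
bookkeeping needs the size of `freeK` itself.  From `freeK_eq_curvatureTwoPoint` / `curvatureTwoPoint_zeroOne_eq_latticeGreen`
(`freeK = −½(Δ₀ + Δ₁)G`, `Δ_μ` the centred second difference, `G = latticeGreen`), the decay of second differences of `G` away from the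
time-zero hyperplane (`LogWindowMixedDominanceGreenDecay.abs_diff_ss_le`: `|Δ_aΔ_bG(n,x)| ≤ C/n⁴`, two spatial differences), the Poisson
equation `ΔG = −2δ₀` (temporal second difference = minus the three spatial ones off the origin) and the permutation symmetry of `G`
(`latticeGreen_comp_equiv`: the largest coordinate of `z` can be taken as the time coordinate):

* `freeK_neg`, `freeK_zero : freeK 0 = 1/2` (`curvatureTwoPoint_self`: `c₀ = 2/d` at `d = 4`);
* `abs_latticeGreen_secondDiff_le`: `|G(s+e_ν) + G(s−e_ν) − 2G(s)| ≤ 3C/n⁴` at every site `s = (n, x)` with `n ≥ 1`, every direction `ν`;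
* **`abs_freeK_le_of_ne_zero`**: `|freeK z| ≤ 3C/‖z‖_∞⁴` for `z ≠ 0` (`‖z‖_∞ = Site.supNorm z`), with the explicit constant
  `C = (π/2)(2·12³/(2/(3π))⁴)/(2π)³` of the tree;
* **`exists_abs_freeK_le`**: `∃ C', ∀ z, |freeK z| ≤ C'/(1 + ‖z‖_∞)⁴`.

Orders of magnitude only (the true decay is `c|z|⁻⁴` with an angular profile; no asymptotic constant is matched).  RECORD-type material on
an abelian comparison line; the Yang–Mills mass gap is NOT proved by anything here.
-/

set_option autoImplicit false

noncomputable section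

namespace Summit.QuantumFields.YangMills.Theorems.U1DipoleHelicity

open MeasureTheory Finset
open scoped Real
open Literature.Probability.LatticeModels Literature.MathematicalPhysics.QuantumFieldTheory
open Summit.QuantumFields.YangMills.Theorems.HankelDensitySplitting.LogWindow

/-! ### Symmetry and the value at the origin -/

/-- `freeK` is even. [folklore] -/
theorem freeK_neg (z : Literature.Probability.LatticeModels.Site 4) : freeK (-z) = freeK z := by
  unfold freeK
  congr 1
  refine integral_congr_ae (Filter.Eventually.of_forall fun k => ?_)
  have h : ∑ i : Fin 4, k i * (((-z) i : ℤ) : ℝ) = -∑ i : Fin 4, k i * ((z i : ℤ) : ℝ) := by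
    rw [← Finset.sum_neg_distrib]
    refine Finset.sum_congr rfl fun i _ => ?_
    rw [Pi.neg_apply, Int.cast_neg, mul_neg]
  simp only [h, Real.cos_neg]

/-- **`freeK 0 = 1/2`**: each of the four directions carries a quarter of `Σ_μ k̂_μ²/k̂² = 1` (the tree's `curvatureTwoPoint_self`:
the diagonal value of the lattice-Maxwell kernel is `2/d`). [folklore] -/
theorem freeK_zero : freeK 0 = 1 / 2 := by
  rw [freeK_eq_curvatureTwoPoint, curvatureTwoPoint_self (by norm_num)]
  norm_num

/-! ### Second differences of the lattice Green function at sites `(n, x)`, `n ≥ 1` -/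

/-- `(n, x) + e_{a+1} = (n, x + e_a)`. [folklore] -/
theorem cons_add_single_succ (n : ℤ) (x : Fin 3 → ℤ) (a : Fin 3) (c : ℤ) :
    (Fin.cons n x : Literature.Probability.LatticeModels.Site 4) + Pi.single a.succ c = Fin.cons n (x + Pi.single a c) := by
  funext i
  refine Fin.cases ?_ (fun j => ?_) i
  · simp [Fin.succ_ne_zero]
  · simp only [Pi.add_apply, Fin.cons_succ, Pi.single_apply, Fin.succ_inj]

/-- `(n, x) - c e_{a+1} = (n, x - c e_a)`. [folklore] -/
theorem cons_sub_single_succ (n : ℤ) (x : Fin 3 → ℤ) (a : Fin 3) (c : ℤ) :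
    (Fin.cons n x : Literature.Probability.LatticeModels.Site 4) - Pi.single a.succ c = Fin.cons n (x - Pi.single a c) := by
  rw [sub_eq_add_neg, ← Pi.single_neg, cons_add_single_succ, sub_eq_add_neg, ← Pi.single_neg]

/-- `(n, x) + c e₀ = (n + c, x)`. [folklore] -/
theorem cons_add_single_zero (n : ℤ) (x : Fin 3 → ℤ) (c : ℤ) :
    (Fin.cons n x : Literature.Probability.LatticeModels.Site 4) + Pi.single 0 c = Fin.cons (n + c) x := by
  funext i
  refine Fin.cases ?_ (fun j => ?_) i
  · simp
  · simp [Fin.succ_ne_zero]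

/-- `(n, x) - c e₀ = (n - c, x)`. [folklore] -/
theorem cons_sub_single_zero (n : ℤ) (x : Fin 3 → ℤ) (c : ℤ) :
    (Fin.cons n x : Literature.Probability.LatticeModels.Site 4) - Pi.single 0 c = Fin.cons (n - c) x := by
  rw [sub_eq_add_neg, ← Pi.single_neg, cons_add_single_zero, sub_eq_add_neg]

/-- **Spatial second differences**: `|G(n, x+e_a) + G(n, x−e_a) − 2G(n, x)| ≤ C/n⁴` for `n ≥ 1` (the tree's `abs_diff_ss_le` with
`a = b`, based at `x − e_a`). [folklore] -/
theorem abs_latticeGreen_secondDiff_spatial_le (a : Fin 3) {n : ℕ} (hn : 1 ≤ n) (x : Fin 3 → ℤ) :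
    |latticeGreen (Fin.cons (n : ℤ) (x + Pi.single a 1) : Literature.Probability.LatticeModels.Site 4) +
        latticeGreen (Fin.cons (n : ℤ) (x - Pi.single a 1) : Literature.Probability.LatticeModels.Site 4) -
        2 * latticeGreen (Fin.cons (n : ℤ) x : Literature.Probability.LatticeModels.Site 4)| ≤
      π / 2 * (2 * 12 ^ 3 / (2 / (3 * π)) ^ 4) / (n : ℝ) ^ 4 / (2 * π) ^ 3 := by
  have h := GreenDecay.abs_diff_ss_le a a hn (x - Pi.single a 1)
  have e1 : x - Pi.single a 1 + Pi.single a 1 + Pi.single a 1 = x + Pi.single a 1 := by abel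
  have e2 : x - Pi.single a 1 + Pi.single a 1 = x := by abel
  rw [e1, e2] at h
  have e3 : latticeGreen (Fin.cons (n : ℤ) (x + Pi.single a 1) : Literature.Probability.LatticeModels.Site 4) +
        latticeGreen (Fin.cons (n : ℤ) (x - Pi.single a 1) : Literature.Probability.LatticeModels.Site 4) -
        2 * latticeGreen (Fin.cons (n : ℤ) x : Literature.Probability.LatticeModels.Site 4) =
      latticeGreen (Fin.cons (n : ℤ) (x + Pi.single a 1) : Literature.Probability.LatticeModels.Site 4) -
        latticeGreen (Fin.cons (n : ℤ) x : Literature.Probability.LatticeModels.Site 4) -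
        latticeGreen (Fin.cons (n : ℤ) x : Literature.Probability.LatticeModels.Site 4) +
        latticeGreen (Fin.cons (n : ℤ) (x - Pi.single a 1) : Literature.Probability.LatticeModels.Site 4) := by ring
  rw [e3]
  exact h

/-- **Temporal second difference** via the Poisson equation `ΔG = −2δ₀`: at a site `(n, x)` with `n ≥ 1` (not the origin),
`G(n+1, x) + G(n−1, x) − 2G(n, x) = −Σ_a (G(n, x+e_a) + G(n, x−e_a) − 2G(n, x))`, hence `≤ 3C/n⁴` in absolute value. [folklore] -/
theorem abs_latticeGreen_secondDiff_temporal_le {n : ℕ} (hn : 1 ≤ n) (x : Fin 3 → ℤ) :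
    |latticeGreen (Fin.cons ((n : ℤ) + 1) x : Literature.Probability.LatticeModels.Site 4) +
        latticeGreen (Fin.cons ((n : ℤ) - 1) x : Literature.Probability.LatticeModels.Site 4) -
        2 * latticeGreen (Fin.cons (n : ℤ) x : Literature.Probability.LatticeModels.Site 4)| ≤
      3 * (π / 2 * (2 * 12 ^ 3 / (2 / (3 * π)) ^ 4) / (n : ℝ) ^ 4 / (2 * π) ^ 3) := by
  set s : Literature.Probability.LatticeModels.Site 4 := Fin.cons (n : ℤ) x with hs
  have hs0 : s ≠ 0 := by
    intro h
    have := congrFun h 0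
    simp only [hs, Fin.cons_zero, Pi.zero_apply] at this
    omega
  have hP := latticeLaplacianZd_latticeGreen_of_ne_zero 4 (by norm_num) hs0
  rw [latticeLaplacianZd_def, Fin.sum_univ_succ] at hP
  -- rewrite the neighbours of `s`
  have ht1 : s + Pi.single 0 1 = Fin.cons ((n : ℤ) + 1) x := by rw [hs, cons_add_single_zero]
  have ht2 : s - Pi.single 0 1 = Fin.cons ((n : ℤ) - 1) x := by rw [hs, cons_sub_single_zero]
  have hsp : ∀ a : Fin 3, s + Pi.single a.succ 1 = Fin.cons (n : ℤ) (x + Pi.single a 1) := fun a => by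
    rw [hs, cons_add_single_succ]
  have hsm : ∀ a : Fin 3, s - Pi.single a.succ 1 = Fin.cons (n : ℤ) (x - Pi.single a 1) := fun a => by
    rw [hs, cons_sub_single_succ]
  simp only [ht1, ht2, hsp, hsm] at hP
  -- the temporal second difference is minus the sum of the spatial ones
  have key : latticeGreen (Fin.cons ((n : ℤ) + 1) x : Literature.Probability.LatticeModels.Site 4) +
        latticeGreen (Fin.cons ((n : ℤ) - 1) x : Literature.Probability.LatticeModels.Site 4) -
        2 * latticeGreen (Fin.cons (n : ℤ) x : Literature.Probability.LatticeModels.Site 4) =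
      -∑ a : Fin 3, (latticeGreen (Fin.cons (n : ℤ) (x + Pi.single a 1) : Literature.Probability.LatticeModels.Site 4) +
        latticeGreen (Fin.cons (n : ℤ) (x - Pi.single a 1) : Literature.Probability.LatticeModels.Site 4) -
        2 * latticeGreen (Fin.cons (n : ℤ) x : Literature.Probability.LatticeModels.Site 4)) := by
    rw [← hs]
    simp only [Finset.sum_sub_distrib, Finset.sum_const, Finset.card_univ, Fintype.card_fin, nsmul_eq_mul] at hP ⊢
    push_cast at hP ⊢
    linarith
  rw [key, abs_neg]
  calc |∑ a : Fin 3, (latticeGreen (Fin.cons (n : ℤ) (x + Pi.single a 1) : Literature.Probability.LatticeModels.Site 4) +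
          latticeGreen (Fin.cons (n : ℤ) (x - Pi.single a 1) : Literature.Probability.LatticeModels.Site 4) -
          2 * latticeGreen (Fin.cons (n : ℤ) x : Literature.Probability.LatticeModels.Site 4))|
      ≤ ∑ a : Fin 3, |latticeGreen (Fin.cons (n : ℤ) (x + Pi.single a 1) : Literature.Probability.LatticeModels.Site 4) +
          latticeGreen (Fin.cons (n : ℤ) (x - Pi.single a 1) : Literature.Probability.LatticeModels.Site 4) -
          2 * latticeGreen (Fin.cons (n : ℤ) x : Literature.Probability.LatticeModels.Site 4)| := Finset.abs_sum_le_sum_abs _ _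
    _ ≤ ∑ _a : Fin 3, π / 2 * (2 * 12 ^ 3 / (2 / (3 * π)) ^ 4) / (n : ℝ) ^ 4 / (2 * π) ^ 3 :=
        Finset.sum_le_sum fun a _ => abs_latticeGreen_secondDiff_spatial_le a hn x
    _ = 3 * (π / 2 * (2 * 12 ^ 3 / (2 / (3 * π)) ^ 4) / (n : ℝ) ^ 4 / (2 * π) ^ 3) := by
        rw [Finset.sum_const, Finset.card_univ, Fintype.card_fin, nsmul_eq_mul, Nat.cast_ofNat]

/-- **Every second difference at a site `(n, x)`, `n ≥ 1`, is `≤ 3C/n⁴`** (spatial directions: `C/n⁴ ≤ 3C/n⁴`; temporal: Poisson).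
[folklore] -/
theorem abs_latticeGreen_secondDiff_le (ν : Fin 4) {n : ℕ} (hn : 1 ≤ n) (x : Fin 3 → ℤ) :
    |latticeGreen ((Fin.cons (n : ℤ) x : Literature.Probability.LatticeModels.Site 4) + Pi.single ν 1) +
        latticeGreen ((Fin.cons (n : ℤ) x : Literature.Probability.LatticeModels.Site 4) - Pi.single ν 1) -
        2 * latticeGreen (Fin.cons (n : ℤ) x : Literature.Probability.LatticeModels.Site 4)| ≤
      3 * (π / 2 * (2 * 12 ^ 3 / (2 / (3 * π)) ^ 4) / (n : ℝ) ^ 4 / (2 * π) ^ 3) := by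
  refine Fin.cases ?_ (fun a => ?_) ν
  · rw [cons_add_single_zero, cons_sub_single_zero]
    exact abs_latticeGreen_secondDiff_temporal_le hn x
  · rw [cons_add_single_succ, cons_sub_single_succ]
    refine (abs_latticeGreen_secondDiff_spatial_le a hn x).trans ?_
    have h0 : 0 ≤ π / 2 * (2 * 12 ^ 3 / (2 / (3 * π)) ^ 4) / (n : ℝ) ^ 4 / (2 * π) ^ 3 := by positivity
    linarith

/-! ### Permutation symmetry: the largest coordinate as the time coordinate -/

/-- `e_μ ∘ σ = e_{σ⁻¹ μ}` for a permutation `σ` of the coordinates. [folklore] -/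
theorem single_comp_equiv (σ : Equiv.Perm (Fin 4)) (μ : Fin 4) (c : ℤ) :
    ((Pi.single μ c : Literature.Probability.LatticeModels.Site 4) ∘ σ) = Pi.single (σ.symm μ) c := by
  funext i
  simp only [Function.comp_apply, Pi.single_apply, Equiv.apply_eq_iff_eq_symm_apply]

/-- Second differences are permutation-covariant: `Δ_μ G(z) = Δ_{σ⁻¹μ} G(z ∘ σ)`. [folklore] -/
theorem latticeGreen_secondDiff_comp_equiv (σ : Equiv.Perm (Fin 4)) (z : Literature.Probability.LatticeModels.Site 4) (μ : Fin 4) :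
    latticeGreen (z + Pi.single μ 1) + latticeGreen (z - Pi.single μ 1) - 2 * latticeGreen z =
      latticeGreen (z ∘ σ + Pi.single (σ.symm μ) 1) + latticeGreen (z ∘ σ - Pi.single (σ.symm μ) 1) -
        2 * latticeGreen (z ∘ σ) := by
  rw [← latticeGreen_comp_equiv σ (z + Pi.single μ 1), ← latticeGreen_comp_equiv σ (z - Pi.single μ 1),
    ← latticeGreen_comp_equiv σ z]
  have hadd : ((z + Pi.single μ 1) ∘ σ) = z ∘ σ + Pi.single (σ.symm μ) 1 := by
    rw [← single_comp_equiv σ μ 1]; rfl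
  have hsub : ((z - Pi.single μ 1) ∘ σ) = z ∘ σ - Pi.single (σ.symm μ) 1 := by
    rw [← single_comp_equiv σ μ 1]; rfl
  rw [hadd, hsub]

/-- `freeK` as minus half the sum of the two longitudinal second differences of `G`. [folklore] -/
theorem freeK_eq_secondDiff (z : Literature.Probability.LatticeModels.Site 4) :
    freeK z = -(1 / 2) * ((latticeGreen (z + Pi.single 0 1) + latticeGreen (z - Pi.single 0 1) - 2 * latticeGreen z) +
      (latticeGreen (z + Pi.single 1 1) + latticeGreen (z - Pi.single 1 1) - 2 * latticeGreen z)) := by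
  rw [freeK_eq_curvatureTwoPoint, curvatureTwoPoint_zeroOne_eq_latticeGreen]
  ring

/-- The decay bound when a given coordinate `c` of `z` equals `m ≥ 1`. [folklore] -/
theorem abs_freeK_le_of_apply_eq (z : Literature.Probability.LatticeModels.Site 4) (c : Fin 4) {m : ℕ} (hm : 1 ≤ m)
    (hzc : z c = m) :
    |freeK z| ≤ 3 * (π / 2 * (2 * 12 ^ 3 / (2 / (3 * π)) ^ 4) / (m : ℝ) ^ 4 / (2 * π) ^ 3) := by
  set σ : Equiv.Perm (Fin 4) := Equiv.swap 0 c with hσ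
  have hz' : z ∘ σ = Fin.cons (m : ℤ) (Fin.tail (z ∘ σ)) := by
    rw [← hzc]
    have h0 : (z ∘ σ) 0 = z c := by simp [hσ, Equiv.swap_apply_left]
    conv_lhs => rw [← Fin.cons_self_tail (z ∘ σ)]
    rw [h0]
  rw [freeK_eq_secondDiff, latticeGreen_secondDiff_comp_equiv σ z 0, latticeGreen_secondDiff_comp_equiv σ z 1, hz']
  have h1 := abs_latticeGreen_secondDiff_le (σ.symm 0) hm (Fin.tail (z ∘ σ))
  have h2 := abs_latticeGreen_secondDiff_le (σ.symm 1) hm (Fin.tail (z ∘ σ))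
  rw [abs_mul, abs_neg, abs_of_pos (by norm_num : (0 : ℝ) < 1 / 2)]
  have h3 := abs_add_le
    (latticeGreen ((Fin.cons (m : ℤ) (Fin.tail (z ∘ σ)) : Literature.Probability.LatticeModels.Site 4) + Pi.single (σ.symm 0) 1) +
      latticeGreen ((Fin.cons (m : ℤ) (Fin.tail (z ∘ σ)) : Literature.Probability.LatticeModels.Site 4) - Pi.single (σ.symm 0) 1) -
      2 * latticeGreen (Fin.cons (m : ℤ) (Fin.tail (z ∘ σ)) : Literature.Probability.LatticeModels.Site 4))
    (latticeGreen ((Fin.cons (m : ℤ) (Fin.tail (z ∘ σ)) : Literature.Probability.LatticeModels.Site 4) + Pi.single (σ.symm 1) 1) +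
      latticeGreen ((Fin.cons (m : ℤ) (Fin.tail (z ∘ σ)) : Literature.Probability.LatticeModels.Site 4) - Pi.single (σ.symm 1) 1) -
      2 * latticeGreen (Fin.cons (m : ℤ) (Fin.tail (z ∘ σ)) : Literature.Probability.LatticeModels.Site 4))
  linarith

/-- `‖z‖_∞ = ‖−z‖_∞`. [folklore] -/
theorem supNorm_neg (z : Literature.Probability.LatticeModels.Site 4) : Site.supNorm (-z) = Site.supNorm z := by
  unfold Site.supNorm
  simp only [Pi.neg_apply, Int.natAbs_neg]

/-- **Dipole decay of the free photon kernel**: `|freeK z| ≤ 3C/‖z‖_∞⁴` for `z ≠ 0`, `C = (π/2)(2·12³/(2/(3π))⁴)/(2π)³`. [folklore] -/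
theorem abs_freeK_le_of_ne_zero (z : Literature.Probability.LatticeModels.Site 4) (hz : z ≠ 0) :
    |freeK z| ≤ 3 * (π / 2 * (2 * 12 ^ 3 / (2 / (3 * π)) ^ 4) / (Site.supNorm z : ℝ) ^ 4 / (2 * π) ^ 3) := by
  -- a coordinate realising the sup norm
  obtain ⟨c, -, hc⟩ := Finset.exists_mem_eq_sup (Finset.univ : Finset (Fin 4)) Finset.univ_nonempty fun i => (z i).natAbs
  have hm : 1 ≤ Site.supNorm z := by
    by_contra h
    push Not at h
    have h0 : Site.supNorm z = 0 := by omega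
    apply hz
    funext i
    have := Site.natAbs_le_supNorm z i
    rw [h0] at this
    simpa using this
  have hcz : (z c).natAbs = Site.supNorm z := by rw [Site.supNorm, hc]
  -- sign of `z c`
  rcases Int.natAbs_eq (z c) with hpos | hneg
  · exact abs_freeK_le_of_apply_eq z c hm (by rw [hpos, hcz])
  · rw [← freeK_neg, ← supNorm_neg]
    refine abs_freeK_le_of_apply_eq (-z) c (by rwa [supNorm_neg]) ?_
    rw [Pi.neg_apply, hneg, neg_neg, supNorm_neg, hcz]

/-- **Uniform form**: there is `C'` with `|freeK z| ≤ C'/(1 + ‖z‖_∞)⁴` for every `z ∈ ℤ⁴` (`freeK 0 = 1/2` at the origin,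
`(1+m)⁴ ≤ 16 m⁴` elsewhere). [folklore] -/
theorem exists_abs_freeK_le :
    ∃ C : ℝ, 0 ≤ C ∧ ∀ z : Literature.Probability.LatticeModels.Site 4, |freeK z| ≤ C / (1 + (Site.supNorm z : ℝ)) ^ 4 := by
  set C₀ : ℝ := π / 2 * (2 * 12 ^ 3 / (2 / (3 * π)) ^ 4) / (2 * π) ^ 3 with hC₀
  have hC₀pos : 0 ≤ C₀ := by positivity
  refine ⟨48 * C₀ + 1 / 2, by positivity, fun z => ?_⟩
  by_cases hz : z = 0
  · subst hz
    have h0 : Site.supNorm (0 : Literature.Probability.LatticeModels.Site 4) = 0 := by simp [Site.supNorm]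
    rw [freeK_zero, h0, Nat.cast_zero, add_zero, one_pow, div_one, abs_of_pos (by norm_num : (0 : ℝ) < 1 / 2)]
    linarith
  · have h := abs_freeK_le_of_ne_zero z hz
    set m : ℝ := (Site.supNorm z : ℝ) with hm
    have hm1 : (1 : ℝ) ≤ m := by
      have : 1 ≤ Site.supNorm z := by
        by_contra h'
        push Not at h'
        have h0 : Site.supNorm z = 0 := by omega
        apply hz
        funext i
        have := Site.natAbs_le_supNorm z i
        rw [h0] at this
        simpa using this
      rw [hm]; exact_mod_cast this
    have hrw : 3 * (π / 2 * (2 * 12 ^ 3 / (2 / (3 * π)) ^ 4) / m ^ 4 / (2 * π) ^ 3) = 3 * C₀ / m ^ 4 := by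
      rw [hC₀]; field_simp
    rw [hrw] at h
    refine h.trans ?_
    rw [div_le_div_iff₀ (by positivity) (by positivity)]
    have h16 : (1 + m) ^ 4 ≤ 16 * m ^ 4 := by nlinarith [hm1, sq_nonneg (m - 1), sq_nonneg m, mul_pos (by positivity : (0:ℝ) < m) (by positivity : (0:ℝ) < m ^ 2)]
    nlinarith [h16, hC₀pos, pow_pos (by positivity : (0 : ℝ) < m) 4]

end Summit.QuantumFields.YangMills.Theorems.U1DipoleHelicity

end
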